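import Literature.NumberTheory.ComplexMultiplication.FiniteQAlgebraLatticeMaximalOrderInvertible
import Literature.NumberTheory.ComplexMultiplication.CMAlgebraLatticeClassesClassGroup
import HarnessLib

/-!
# The class group of the maximal order of a separable `ℚ`-algebra (Hertling–Larabi 2026, Cor. 6.2 (c))

[topic NumberTheory/ComplexMultiplication] General-`A` series, sequel of `FiniteQAlgebraLatticeMaximalOrderInvertible`.
Source, VERBATIM: C. Hertling, K. Larabi, *Semigroups from full lattices in commutative ℚ-algebras*, arXiv:2602.14973
(2026) [HertlingLarabi2026], §6 Cor. 6.2, chunk p0015: «Let `A` be separable, so `A = ⊕_{j=1}^k A^{(j)}` with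
`A^{(1)}, ..., A^{(k)}` algebraic number fields. […] (c) The group `G([Λ_max]_ε)` is finite and isomorphic to the
product `∏_{j=1}^k G([Λ_max(A^{(j)})]_ε)` of the class groups of the algebraic numbers fields `A^{(1)}, ..., A^{(k)}`.»
(Thm. 6.1 (c), one field: «The group `G([Λ_max(A)]_ε)` […] is finite. It is the class group of `A`.»)

The tree has (c) for the literal product `Y = L_1 ⊕ ⋯ ⊕ L_t`
(`CMAlgebraLatticeClassesClassGroup.nonempty_quot_isFullLattice_pi_equiv_pi_classGroup`,
`natCard_quot_isFullLattice_pi_eq_prod_classNumber`). Here `A` is any finite-dimensional commutative `ℚ`-algebra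
GIVEN with a ring isomorphism `e : A ≅ ∏_i L_i` onto a product of number fields (which exists iff `A` is separable,
e.g. Mathlib's `IsArtinianRing.equivPi`), and `Λ_max(A)` is the `ℤ`-submodule of `ℤ`-integral elements
(`FiniteQAlgebraLatticeMaximalOrder`): the `ε`-classes of full lattices `M ⊂ A` with `MΛ_max(A) ⊆ M` — the group
`G([Λ_max(A)]_ε)` by `FiniteQAlgebraLatticeMaximalOrderInvertible.mul_div_eq_of_forall_mul_mem_integralClosure` —
correspond bijectively to those of `∏ L_i` (§1, `ε`-classes transport BIJECTIVELY along ring isomorphisms), hence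
to `∏_i Cl(𝒪_{L_i})`, and number `∏_i h(L_i)`.

## What is formalised

* §1 (any commutative rings) `nonempty_quot_equiv_of_ringEquiv`: for `e : A ≃+* A′` and lattice properties with
  `P(M) ⟺ P′(e(M))`, `[M]_ε ↦ [e(M)]_ε` is a bijection of `ε`-class sets; `natCard_quot_eq_of_ringEquiv`.
* §2 **COROLLARY 6.2 (c)**: `nonempty_quot_isFullLattice_integralClosure_equiv_pi_classGroup`
  (`G([Λ_max(A)]_ε) ≃ ∏_i ClassGroup (𝓞 (L_i))`) and `natCard_quot_isFullLattice_integralClosure_eq_prod_classNumber`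
  (`#G([Λ_max(A)]_ε) = ∏_i h(L_i)`).

## References
* [HertlingLarabi2026] C. Hertling, K. Larabi, arXiv:2602.14973 (2026), §6 Thm. 6.1 (c), Cor. 6.2 (c).
  [cite: HertlingLarabi2026, §6 Cor. 6.2 (c), chunk p0015]
* [Shimura1998] G. Shimura, *Abelian varieties with complex multiplication and modular functions*, §7.4 Prop. 17,
  p. 58 (the tree's `Y`-count). [MilneCM2006] J. S. Milne, *Complex multiplication*, Ch. II Prop. 7.41.
-/

noncomputable section

open scoped Classical Pointwise NumberField
open Submodule Module NumberField

namespace Literature.NumberTheory.ComplexMultiplication.FiniteQAlgebraLattice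

open Literature.NumberTheory.Automorphic (IsFullLattice)
open Literature.LinearAlgebra.Matrix.LatimerMacDuffeeSquarefree (isFullLattice_map equivalence_exists_units_smul)

/-! ## §1 `ε`-classes correspond bijectively under a ring isomorphism -/

section Transport

variable {B B' : Type*} [CommRing B] [CommRing B']

/-- `e⁻¹(e(M)) = M`. [folklore] -/
private theorem map_map_symm (e : B ≃+* B') (M : Submodule ℤ B) :
    (M.map (e : B →+ B').toIntLinearMap).map (e.symm : B' →+ B).toIntLinearMap = M := by
  ext x
  simp only [Submodule.mem_map]
  constructor
  · rintro ⟨y, ⟨z, hz, rfl⟩, rfl⟩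
    simpa using hz
  · intro hx
    exact ⟨e x, ⟨x, hx, rfl⟩, by simp⟩

/-- `e(e⁻¹(M′)) = M′`. [folklore] -/
private theorem map_symm_map (e : B ≃+* B') (M' : Submodule ℤ B') :
    (M'.map (e.symm : B' →+ B).toIntLinearMap).map (e : B →+ B').toIntLinearMap = M' := by
  have h := map_map_symm e.symm M'
  rwa [RingEquiv.symm_symm] at h

/-- `e(u • M) = e(u) • e(M)`. [folklore] -/
private theorem map_units_smul_eq (e : B ≃+* B') (u : Bˣ) (M : Submodule ℤ B) :
    (u • M).map (e : B →+ B').toIntLinearMap =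
      Units.map (e : B →* B') u • M.map (e : B →+ B').toIntLinearMap := by
  ext y
  simp only [Submodule.mem_map]
  constructor
  · rintro ⟨x, ⟨m, hm, rfl⟩, rfl⟩
    exact ⟨e m, ⟨m, hm, rfl⟩, by simp⟩
  · rintro ⟨w, ⟨m, hm, rfl⟩, rfl⟩
    exact ⟨u • m, ⟨m, hm, rfl⟩, by simp [Units.smul_def]⟩

/-- **`[M]_ε ↦ [e(M)]_ε` is a BIJECTION** between the `ε`-classes of lattices of `A` with a property `P` and those of
`A′` with `P′`, whenever `e : A ≅ A′` is a ring isomorphism with `P(M) ⟺ P′(e(M))` — how «`A = ⊕_j A^{(j)}`»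
identifications move class sets. [cite: HertlingLarabi2026, §6 Cor. 6.2 («Let `A` be separable, so `A = ⊕ A^{(j)}`»), chunk p0015]
[cite: HertlingLarabi2026b, §3 Thm. 3.1 (ii) («respects addition, multiplication and division»), chunk p0006] -/
theorem nonempty_quot_equiv_of_ringEquiv (e : B ≃+* B') {P : Submodule ℤ B → Prop} {P' : Submodule ℤ B' → Prop}
    (hPP' : ∀ M, P M ↔ P' (M.map (e : B →+ B').toIntLinearMap)) :
    Nonempty (Quot (fun M M' : {M : Submodule ℤ B // P M} => ∃ u : Bˣ, u • M.1 = M'.1) ≃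
      Quot (fun M M' : {M : Submodule ℤ B' // P' M} => ∃ u : B'ˣ, u • M.1 = M'.1)) := by
  have hP'P : ∀ M', P' M' ↔ P (M'.map (e.symm : B' →+ B).toIntLinearMap) := fun M' => by
    rw [hPP', map_symm_map]
  obtain ⟨F, hF⟩ : ∃ F : {M : Submodule ℤ B // P M} → {M : Submodule ℤ B' // P' M},
      ∀ M, (F M).1 = M.1.map (e : B →+ B').toIntLinearMap := ⟨fun M => ⟨_, (hPP' M.1).1 M.2⟩, fun M => rfl⟩
  obtain ⟨G, hG⟩ : ∃ G : {M : Submodule ℤ B' // P' M} → {M : Submodule ℤ B // P M},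
      ∀ M, (G M).1 = M.1.map (e.symm : B' →+ B).toIntLinearMap := ⟨fun M => ⟨_, (hP'P M.1).1 M.2⟩, fun M => rfl⟩
  have hFr : ∀ ⦃M₁ M₂ : {M : Submodule ℤ B // P M}⦄, (∃ u : Bˣ, u • M₁.1 = M₂.1) →
      ∃ u' : B'ˣ, u' • (F M₁).1 = (F M₂).1 := by
    rintro M₁ M₂ ⟨u, hu⟩
    refine ⟨Units.map (e : B →* B') u, ?_⟩
    rw [hF, hF, ← hu, map_units_smul_eq]
  have hGr : ∀ ⦃M₁ M₂ : {M : Submodule ℤ B' // P' M}⦄, (∃ u : B'ˣ, u • M₁.1 = M₂.1) →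
      ∃ u' : Bˣ, u' • (G M₁).1 = (G M₂).1 := by
    rintro M₁ M₂ ⟨u, hu⟩
    refine ⟨Units.map (e.symm : B' →* B) u, ?_⟩
    rw [hG, hG, ← hu, map_units_smul_eq]
  refine ⟨{ toFun := Quot.map F hFr, invFun := Quot.map G hGr, left_inv := ?_, right_inv := ?_ }⟩
  · rintro ⟨M⟩
    change Quot.mk _ (G (F M)) = Quot.mk _ M
    congr 1
    exact Subtype.ext (by rw [hG, hF, map_map_symm])
  · rintro ⟨M⟩
    change Quot.mk _ (F (G M)) = Quot.mk _ M
    congr 1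
    exact Subtype.ext (by rw [hF, hG, map_symm_map])

/-- So the numbers of classes agree (as `Nat.card`). [cite: HertlingLarabi2026, §6 Cor. 6.2 (c), chunk p0015] -/
theorem natCard_quot_eq_of_ringEquiv (e : B ≃+* B') {P : Submodule ℤ B → Prop} {P' : Submodule ℤ B' → Prop}
    (hPP' : ∀ M, P M ↔ P' (M.map (e : B →+ B').toIntLinearMap)) :
    Nat.card (Quot (fun M M' : {M : Submodule ℤ B // P M} => ∃ u : Bˣ, u • M.1 = M'.1)) =
      Nat.card (Quot (fun M M' : {M : Submodule ℤ B' // P' M} => ∃ u : B'ˣ, u • M.1 = M'.1)) :=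
  Nat.card_congr (nonempty_quot_equiv_of_ringEquiv e hPP').some

end Transport

/-! ## §2 Corollary 6.2 (c) for a separable algebra -/

variable {A : Type} [CommRing A]
variable {t : Type} {L : t → Type} [∀ i, Field (L i)] [∀ i, NumberField (L i)] [Fintype t]

/-- The `Λ_max`-stability property transports: `MΛ_max(A) ⊆ M ⟺ e(M)·(⊕ 𝒪_{L_i}) ⊆ e(M)` (and fullness likewise).
[cite: HertlingLarabi2026, §6 Cor. 6.2 (a) («`Λ_max(A) = ⊕_j Λ_max(A^{(j)})`»), chunk p0015] -/
theorem isFullLattice_and_forall_mul_mem_integralClosure_iff (e : A ≃+* Π i, L i) (M : Submodule ℤ A) :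
    (IsFullLattice A M ∧ ∀ m ∈ M, ∀ a ∈ Subalgebra.toSubmodule (integralClosure ℤ A), m * a ∈ M) ↔
      (IsFullLattice (Π i, L i) (M.map (e : A →+ Π i, L i).toIntLinearMap) ∧
        ∀ m ∈ M.map (e : A →+ Π i, L i).toIntLinearMap,
          ∀ a ∈ Submodule.pi Set.univ (fun i => Subalgebra.toSubmodule (integralClosure ℤ (L i))),
            m * a ∈ M.map (e : A →+ Π i, L i).toIntLinearMap) := by
  rw [← map_toSubmodule_integralClosure_eq_pi e]
  constructor
  · rintro ⟨hM, hst⟩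
    refine ⟨isFullLattice_map e hM, ?_⟩
    rintro _ ⟨m, hm, rfl⟩ _ ⟨a, ha, rfl⟩
    exact ⟨m * a, hst m hm a ha, by simp⟩
  · rintro ⟨hM', hst'⟩
    refine ⟨?_, fun m hm a ha => ?_⟩
    · have h := isFullLattice_map e.symm hM'
      rwa [map_map_symm] at h
    · obtain ⟨x, hx, hxe⟩ := hst' _ ⟨m, hm, rfl⟩ _ ⟨a, ha, rfl⟩
      have : x = m * a := e.injective (by simpa using hxe)
      rwa [this] at hx

/-- **COROLLARY 6.2 (c): «The group `G([Λ_max]_ε)` is […] isomorphic to the product `∏_j G([Λ_max(A^{(j)})]_ε)` of the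
class groups of the algebraic numbers fields»** — for `A ≅ ∏_i L_i` (separable), the `ε`-classes of full lattices
`M ⊂ A` with `MΛ_max(A) ⊆ M` are in bijection with `∏_i Cl(𝒪_{L_i})`. [cite: HertlingLarabi2026, §6 Cor. 6.2 (c), chunk p0015]
[cite: MilneCM2006, Ch. II Prop. 7.41, p. 64] -/
theorem nonempty_quot_isFullLattice_integralClosure_equiv_pi_classGroup (e : A ≃+* Π i, L i) :
    Nonempty (Quot (fun M M' : {M : Submodule ℤ A // IsFullLattice A M ∧
        ∀ m ∈ M, ∀ a ∈ Subalgebra.toSubmodule (integralClosure ℤ A), m * a ∈ M} => ∃ u : Aˣ, u • M.1 = M'.1) ≃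
      ∀ i, ClassGroup (𝓞 (L i))) := by
  obtain ⟨Φ⟩ := nonempty_quot_equiv_of_ringEquiv e
    (P := fun M => IsFullLattice A M ∧ ∀ m ∈ M, ∀ a ∈ Subalgebra.toSubmodule (integralClosure ℤ A), m * a ∈ M)
    (P' := fun M => IsFullLattice (Π i, L i) M ∧ ∀ m ∈ M,
      ∀ a ∈ Submodule.pi Set.univ (fun i => Subalgebra.toSubmodule (integralClosure ℤ (L i))), m * a ∈ M)
    (isFullLattice_and_forall_mul_mem_integralClosure_iff e)
  obtain ⟨Ψ⟩ := nonempty_quot_isFullLattice_pi_equiv_pi_classGroup (L := L)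
  exact ⟨Φ.trans Ψ⟩

/-- **COROLLARY 6.2 (c), counted: `#G([Λ_max(A)]_ε) = ∏_i h(L_i)`** for `A ≅ ∏_i L_i`.
[cite: HertlingLarabi2026, §6 Cor. 6.2 (c), chunk p0015] [cite: Shimura1998, §7.4 Prop. 17, p. 58] -/
theorem natCard_quot_isFullLattice_integralClosure_eq_prod_classNumber (e : A ≃+* Π i, L i) :
    Nat.card (Quot (fun M M' : {M : Submodule ℤ A // IsFullLattice A M ∧
        ∀ m ∈ M, ∀ a ∈ Subalgebra.toSubmodule (integralClosure ℤ A), m * a ∈ M} => ∃ u : Aˣ, u • M.1 = M'.1)) =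
      ∏ i, classNumber (L i) := by
  rw [natCard_quot_eq_of_ringEquiv e
    (P := fun M => IsFullLattice A M ∧ ∀ m ∈ M, ∀ a ∈ Subalgebra.toSubmodule (integralClosure ℤ A), m * a ∈ M)
    (P' := fun M => IsFullLattice (Π i, L i) M ∧ ∀ m ∈ M,
      ∀ a ∈ Submodule.pi Set.univ (fun i => Subalgebra.toSubmodule (integralClosure ℤ (L i))), m * a ∈ M)
    (isFullLattice_and_forall_mul_mem_integralClosure_iff e)]
  exact natCard_quot_isFullLattice_pi_eq_prod_classNumber (L := L)

end Literature.NumberTheory.ComplexMultiplication.FiniteQAlgebraLattice
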